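import Literature.MathematicalPhysics.QuantumFieldTheory.Balaban1983to89.B15Eq112TorusCover
import Literature.MathematicalPhysics.QuantumFieldTheory.Balaban1983to89.B14Eq22Determines
import Literature.MathematicalPhysics.QuantumFieldTheory.Balaban1983to89.TorusGeometry

/-!
# `Balaban1983to89.B14Eq213DetSet` — CMP 119 (2.13)–(2.15) pp. 256–257 ON ONE CARRIER: the maximal sequence
# `Ω = Ω₀ ⊃ Ω₁ ⊃ … ⊃ Ω_j` of a torus domain `Ω ⊂ T_ξ` (r11's ℤᵈ construction `B14.Eq213MaximalDomains.maxDom` DESCENDED to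
# the `Setup` torus through p29's universal cover), the determining set `𝐁_j(Ω)` of (2.13) as r12's (2.2) object
# `B15DeterminingSets.genSet` of that sequence, the localized minimal configurations `U_{j,Ω}`, the join (2.14) and
# `U_{𝐁,Ω}` (2.15); + *"𝐁_j(Ω) determines {Ω_n}"* for it by `B14.Eq22Determines`

statement-level skeleton of published theorems with citation tags; proofs where landed; nothing here is a claim
about the Yang–Mills mass gap.

CITATION HEADER (lean-in-tree rule).  Source: T. Bałaban, *Convergent renormalization expansions for lattice gauge
theories*, Commun. Math. Phys. **119**, 243–285 (1988), doi:10.1007/bf01217741 [Balaban1988Convergent] (cell paper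
B14 = "[III]"; held `paper:balaban1988-cmp119-convergent-renormalization`, journal page = PDF page + 242; pp. 256–257
read on the text layer p0014/p0015 and the x2 renders `…-p014-x2.png`, `…-p015-x2.png`).  Mega-formalization
`lit-balaban`, unit `lit-balaban-r11` (CMP 119, B14 fold owner), SKELETON rows **B14.Eq2.13** (owed member named by the
owner's READING-RULE audit `READING-RULE-AUDIT-B14-g96.md` §4: *"«this determining set 𝐁_j(Ω)» = 𝐁 of (2.2) for the maximal
sequence is NOT one decl (r12's `genSet` lives on `Setup.Site`, `maxDom` on the ℤᵈ cube carrier) … Owed: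
`Bj Ω := genSet (maxDom …)` on one carrier (M: the `cubeIdx` transport)"*) and **B14.Eq2.14–2.15** (batch 2 item (viii)).

THE PRINTED TEXT (pp. 256–257 [PDF 14–15], verbatim).  *"Consider a domain Ω such that it is a union of M₁-cubes in the
lattice T_ξ, ξ = L^{−j}. For this domain we build a minimal determining set with a support in Ω, or a sequence of maximal
domains Ω = Ω₀ ⊃ Ω₁ ⊃ .... ⊃ Ω_j such that Ω_n is a union of LⁿξM₁-cubes, and dist(Ω_n, Ωᶜ_{n−1}) ≧ LⁿξM₁, n = 1, ....,
j (the distance is for the lattice T_ξ). It is easy to see that dist(Ω_j, Ωᶜ) ≦ 2M₁, or Ω^{∼−2} ⊂ Ω_j, where the operation ∼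
is taken for M₁-cubes. We denote this determining set by 𝐁_j(Ω), and the corresponding minimal configurations by
  U(𝐁_j(Ω), ·) = U_{j,Ω}(·) .   (2.13)
… Take the set 𝐁_j(Ω), and form a new determining set by
  𝐁∪𝐁_j(Ω) = (𝐁 ∩ Ω^{∼−2}) ∪ (𝐁_j(Ω) ∩ (Ω∖Ω^{∼−2})) .   (2.14)
The corresponding function is denoted by
  U(𝐁∪𝐁_j(Ω), ·) = U_{𝐁,Ω}(·) .   (2.15)"*

THE ONE-CARRIER READING.  The carrier of record of (2.2)/(2.10)–(2.12) is r12's: `Site P 0 = T_ξ` the finest lattice of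
the current step (here `ξ`), `Site P n = T^{(n)}`, a sequence `Ω : ℕ → Set (Site P 0)`, its determining set
`genSet Ω j : DetSet P` (`Γ₀ = Ω₁ᶜ`, `Γ_n = Ω_n^{(n)}∖Ω^{(n)}_{n+1}`, `Γ_j = Ω_j^{(j)}`), the solution map of (2.12) as the
datum `DetBackground`.  The maximal sequence of (2.13) is r11's `maxDom L M₁ Ω̂ n` on the universal cover `ℤᵈ`
(`B14DomainGeom.Pt d`, cubes of side `s_n = LⁿM₁` sites — lattice units of `T_ξ`, so print's "M₁-cubes of T_ξ" are the
`s_j`-cubes and the "LⁿξM₁-cubes" the `s_n`-cubes), with ALL its printed properties proved there (p248052).  THIS FILE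
descends it: for a torus domain `Ω ⊂ Site P 0` put `Ω̂ = cover⁻¹ Ω` (p29's universal cover `B15Eq112TorusCover.cover :
ℤᵈ → Site P 0`, period `2L^{m+K}` in every direction); `maxDom L M₁ Ω̂ n` is DECK-INVARIANT as soon as the cube side `s_n`
divides the period (§1, the one non-formal point: the construction is translation-covariant under translations by
multiples of the cube side), so it is the pull-back of its image `maxDomT M₁ Ω n := cover '' maxDom L M₁ Ω̂ n ⊂ Site P 0`
(§2) — THE torus maximal sequence, with `Ω₀ = Ω`, nestedness, and the three printed properties (cubes, distance,
maximality) + *"Ω^{∼−2} ⊂ Ω_j"* read on the cover BY NAME from r11's theorems.  §3: the torus maximal domains are unions of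
`n`-blocks of `Setup` (`B14.Eq22Determines.IsBlockUnion`; the block structure of `Setup` — `blockOf` = label division by
`L`, `emb` = centre — matches the `Lⁿ`-cubes of the cover, `TorusGeometry`'s `val_emb`/`val_blockOf`).  §4: **`Bj M₁ Ω j :=
genSet (maxDomT M₁ Ω) j`** — print's `𝐁_j(Ω)` as ONE declaration on the carrier of record —, its members scale by scale,
*"𝐁_j(Ω) determines {Ω_n}"* for it (`B14.Eq22Determines.eq_of_genSet_eq` by name), and (2.13) `U_{j,Ω} := U(𝐁_j(Ω), ·)`
(`minConf`, the solution datum of r12's `DetBackground` AT `𝐁_j(Ω)`, with its defining minimality).  §5: `Ω^{∼−2}` on the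
torus (`innerTwoT`), the join (2.14) = r12's `join214` AT `𝐁_j(Ω)` and `Ω^{∼−2}` (`joinBj`), and (2.15) `U_{𝐁,Ω}`
(`minConfJoin`).
HYPOTHESES, located: `side L M₁ j ∣ 2L^{m+K}` (print's standing arrangement: all scales are powers of `L` below the
torus size; with `M₁ = L^{m₁}`, row B14.Def§1.scales, this is `j + m₁ ≤ m + K`), `1 ≤ M₁`; `n ≤ m + K` (the standing range
of `Setup`) for the block statements.  HONEST SCOPE: set-level; the analytic content of (2.13)/(2.15) — existence and
uniqueness of the minimal orbit, [15] Theorem 1 — stays the datum `DetBackground` (rows B14.Eq2.12, B11.Thm1); the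
displays (2.13), (2.15) themselves are NAMING.  Definitions WITH BODIES (`maxDomT`, `Bj`, `minConf`, `innerTwoT`, `joinBj`,
`minConfJoin`); no structure, no named fact, no `sorry`.

v1.1 (lit-balaban-r11 gen 99, DOCSTRING-ONLY citation-locator fix; summit-lit1 CITELOC row P91-004 of gen 91, decision of
record «(B12, (0.1), p.252) → p.251»): the four block-map tags (`val_blockIter`, `val_embIter_blockIter_div`,
`cubeIdx_lift_blockRep`, `isBlockUnion_image`) citing [I]'s lattice set-up (0.1) read «(0.1) p.252»; (0.1) «T_ε = {x ∈ εZ^d :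
−L_μ ≤ x_μ < L_μ, μ = 1, …, d}» (with the block lattices T^{(k)}_{L^kε} in the next sentence) is the display of CMP **109**
p. 251 [PDF 3, text layer p0003 L29–31]; p. 252 carries (0.2)–(0.3). The tags now read «(0.1) p.251»; no declaration changed.
-/

namespace Literature.MathematicalPhysics.QuantumFieldTheory.Balaban1983to89.B14.Eq213DetSet

open Literature.MathematicalPhysics.QuantumFieldTheory.Balaban1983to89
open B14DomainGeom B14.Eq213MaximalDomains B15LatticeCubeTorus B15Eq112TorusCover B15DeterminingSets
open B14.Eq22Determines

/-! ## §1  The maximal sequence on the universal cover is deck-invariant -/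

section Deck

variable {d : ℕ} {Pv : Fin d → ℕ}

/-- Sup-distances are translation invariant. [folklore] -/
private theorem within_add_iff {r : ℤ} (x y t : Pt d) : Within r (x + t) (y + t) ↔ Within r x y := by
  simp only [Within, Pi.add_apply, add_sub_add_right_eq_sub]

/-- `P·(−v) = −(P·v)`. [folklore] -/
private theorem pmul_neg (Pv : Fin d → ℕ) (v : Pt d) : pmul Pv (-v) = -pmul Pv v := by
  funext μ; simp [pmul]

/-- The cube index of a deck translate, cube side `s ∣ P_μ`: `cubeIdx s (x + P·v) = cubeIdx s x + (P/s)·v`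
(p29's `B15LatticeCubeTorus.cubeIdx_sub_pmul` read forwards). [cite: Balaban1988Convergent, (2.13) pp.256–257] -/
theorem cubeIdx_add_pmul {s : ℕ} (hs : ∀ μ, s ∣ Pv μ) (hs0 : 0 < s) (x v : Pt d) (μ : Fin d) :
    cubeIdx s (x + pmul Pv v) μ = cubeIdx s x μ + ((Pv μ / s : ℕ) : ℤ) * v μ := by
  have h := cubeIdx_sub_pmul (P := Pv) hs hs0 x (-v) μ
  rw [pmul_neg, sub_neg_eq_add] at h
  rw [h, Pi.neg_apply]
  ring

/-- A deck-invariance statement in the one-sided form suffices. [folklore] -/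
private theorem deck_iff_of_imp {Y : Set (Pt d)} (h : ∀ x v, x ∈ Y → x + pmul Pv v ∈ Y) (x v : Pt d) :
    x + pmul Pv v ∈ Y ↔ x ∈ Y := by
  refine ⟨fun hx => ?_, h x v⟩
  have := h _ (-v) hx
  rwa [pmul_neg, add_neg_cancel_right] at this

/-- **Deck invariance of the maximal sequence.**  If `Y ⊂ ℤᵈ` is invariant under the translations `x ↦ x + P·v` and the
cube side `s_n = LⁿM₁` divides every period `P_μ`, then every `maxDom L M₁ Y m`, `m ≤ n`, is invariant too — the
construction of p. 256 (cubes of the `s_m`-partition, sup-distances) is covariant under translations by multiples of the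
cube side. [cite: Balaban1988Convergent, (2.13) pp.256–257] -/
theorem maxDom_add_pmul {L M₁ : ℕ} (hL : 1 ≤ L) (hM : 1 ≤ M₁) {Y : Set (Pt d)}
    (hY : ∀ x v, x + pmul Pv v ∈ Y ↔ x ∈ Y) {n : ℕ} (hdvd : ∀ μ, side L M₁ n ∣ Pv μ) :
    ∀ {m : ℕ}, m ≤ n → ∀ x v, x + pmul Pv v ∈ maxDom L M₁ Y m ↔ x ∈ maxDom L M₁ Y m := by
  -- one-sided form, by induction on `m`
  have himp : ∀ m, m ≤ n → ∀ x v, x ∈ maxDom L M₁ Y m → x + pmul Pv v ∈ maxDom L M₁ Y m := by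
    intro m
    induction m with
    | zero => intro _ x v hx; exact (hY x v).2 hx
    | succ m ih =>
      intro hmn x v hx
      have hsm : ∀ μ, side L M₁ (m + 1) ∣ Pv μ := fun μ => by
        refine dvd_trans ?_ (hdvd μ)
        obtain ⟨t, ht⟩ := Nat.exists_eq_add_of_le hmn
        exact ⟨L ^ t, by rw [ht]; unfold side; ring⟩
      have hs0 : 0 < side L M₁ (m + 1) := side_pos hL hM (m + 1)
      rw [mem_maxDom_succ] at hx ⊢
      intro x' hx' y hy
      -- translate back: `x' − P·v` lies in the cube of `x`, `y − P·v` is close to it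
      have hx'' : cubeIdx (side L M₁ (m + 1)) (x' + pmul Pv (-v)) = cubeIdx (side L M₁ (m + 1)) x := by
        funext μ
        have h1 := cubeIdx_add_pmul hsm hs0 x' (-v) μ
        have h2 := cubeIdx_add_pmul hsm hs0 x v μ
        rw [h1, congrFun hx' μ, h2, Pi.neg_apply]
        ring
      have hy'' : Within ((side L M₁ (m + 1) : ℤ) - 1) (x' + pmul Pv (-v)) (y + pmul Pv (-v)) :=
        (within_add_iff x' y _).2 hy
      have hmem := hx _ hx'' _ hy''
      have := ih (Nat.le_of_succ_le hmn) _ v hmem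
      rwa [pmul_neg, neg_add_cancel_right] at this
  intro m hmn x v
  exact deck_iff_of_imp (himp m hmn) x v

/-- Index-nearness is deck-invariant (cube side `s ∣ P_μ`). [folklore] -/
private theorem idxNear_add_pmul {s n : ℕ} (hs : ∀ μ, s ∣ Pv μ) (hs0 : 0 < s) (x y v : Pt d) :
    IdxNear s n (x + pmul Pv v) (y + pmul Pv v) ↔ IdxNear s n x y := by
  simp only [IdxNear, cubeIdx_add_pmul hs hs0, add_sub_add_right_eq_sub]

/-- **Deck invariance of `Ω^{∼−2}`** (and every `Λ^{∼−n}`): the shrinking by cube layers of a deck-invariant set is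
deck-invariant (cube side `s ∣ P_μ`). [cite: Balaban1988Convergent, (2.13) pp.256–257] -/
theorem innerN_add_pmul {s n : ℕ} (hs : ∀ μ, s ∣ Pv μ) (hs0 : 0 < s) {Y : Set (Pt d)}
    (hY : ∀ x v, x + pmul Pv v ∈ Y ↔ x ∈ Y) (x v : Pt d) :
    x + pmul Pv v ∈ innerN s n Y ↔ x ∈ innerN s n Y := by
  refine deck_iff_of_imp (fun x v hx => ?_) x v
  refine ⟨(hY x v).2 hx.1, fun y hy => ?_⟩
  have hy' : IdxNear s n x (y + pmul Pv (-v)) := by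
    have := (idxNear_add_pmul hs hs0 (x + pmul Pv v) y (-v)).2 hy
    rwa [pmul_neg, add_neg_cancel_right, ← pmul_neg] at this
  have := (hY _ v).2 (hx.2 _ hy')
  rwa [pmul_neg, neg_add_cancel_right] at this

end Deck

/-! ## §2  The torus maximal sequence `Ω = Ω₀ ⊃ Ω₁ ⊃ … ⊃ Ω_j` of a domain `Ω ⊂ T_ξ = Site P 0` -/

section Torus

variable {P : Params} (M₁ : ℕ)

/-- **The maximal sequence of (2.13) on the torus**: `Ω_n := π(maxDom L M₁ (π⁻¹Ω) n)`, `π = cover` the universal cover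
of `T_ξ = Site P 0` — r11's ℤᵈ construction of p. 256 descended to the `Setup` torus.
[cite: Balaban1988Convergent, (2.13) pp.256–257] -/
def maxDomT (Ω : Set (Site P 0)) (n : ℕ) : Set (Site P 0) :=
  cover P '' maxDom P.L M₁ (cover P ⁻¹' Ω) n

variable {M₁}

/-- `1 ≤ L` for the `Setup` parameters. [folklore] -/
private theorem one_le_L (P : Params) : 1 ≤ P.L := P.L_pos

/-- `2 ≤ L` for the `Setup` parameters (`L` odd, `L > 1`). [folklore] -/
private theorem two_le_L (P : Params) : 2 ≤ P.L := P.hL.2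

/-- The pulled-back maximal sequence is deck-invariant at every scale `n ≤ j` once `s_j = LʲM₁` divides the torus size
`2L^{m+K}`. [cite: Balaban1988Convergent, (2.13) pp.256–257] -/
theorem maxDom_cover_deck (hM : 1 ≤ M₁) {Ω : Set (Site P 0)} {j : ℕ} (hdiv : side P.L M₁ j ∣ P.sitesPerDir 0)
    {n : ℕ} (hn : n ≤ j) (x v : Pt P.d) :
    x + pmul (per P) v ∈ maxDom P.L M₁ (cover P ⁻¹' Ω) n ↔ x ∈ maxDom P.L M₁ (cover P ⁻¹' Ω) n :=
  maxDom_add_pmul (one_le_L P) hM (preimage_deck Ω) (fun _ => hdiv) hn x v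

/-- **The torus maximal domain IS r11's ℤᵈ one, read on the cover**: `π⁻¹ Ω_n = maxDom L M₁ (π⁻¹Ω) n` (`n ≤ j`,
`s_j ∣ 2L^{m+K}`). [cite: Balaban1988Convergent, (2.13) pp.256–257] -/
theorem preimage_maxDomT (hM : 1 ≤ M₁) {Ω : Set (Site P 0)} {j : ℕ} (hdiv : side P.L M₁ j ∣ P.sitesPerDir 0)
    {n : ℕ} (hn : n ≤ j) : cover P ⁻¹' maxDomT M₁ Ω n = maxDom P.L M₁ (cover P ⁻¹' Ω) n :=
  preimage_image_of_deck (maxDom_cover_deck hM hdiv hn)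

/-- Membership of a torus point in `Ω_n` is decided by its standard lift. [cite: Balaban1988Convergent, (2.13) pp.256–257] -/
theorem mem_maxDomT_iff (hM : 1 ≤ M₁) {Ω : Set (Site P 0)} {j : ℕ} (hdiv : side P.L M₁ j ∣ P.sitesPerDir 0)
    {n : ℕ} (hn : n ≤ j) (a : Site P 0) : a ∈ maxDomT M₁ Ω n ↔ lift P a ∈ maxDom P.L M₁ (cover P ⁻¹' Ω) n := by
  have h : lift P a ∈ cover P ⁻¹' maxDomT M₁ Ω n ↔ lift P a ∈ maxDom P.L M₁ (cover P ⁻¹' Ω) n := by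
    rw [preimage_maxDomT hM hdiv hn]
  rwa [Set.mem_preimage, cover_lift] at h

/-- *"Ω = Ω₀"*. [cite: Balaban1988Convergent, (2.13) pp.256–257] -/
@[simp] theorem maxDomT_zero (Ω : Set (Site P 0)) : maxDomT M₁ Ω 0 = Ω := by
  unfold maxDomT
  rw [maxDom_zero]
  exact image_preimage Ω

/-- *"Ω₀ ⊃ Ω₁ ⊃ … ⊃ Ω_j"*: `Ω_{n+1} ⊆ Ω_n`. [cite: Balaban1988Convergent, (2.13) pp.256–257] -/
theorem maxDomT_succ_subset (hM : 1 ≤ M₁) (Ω : Set (Site P 0)) (n : ℕ) : maxDomT M₁ Ω (n + 1) ⊆ maxDomT M₁ Ω n :=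
  Set.image_mono (maxDom_succ_subset (one_le_L P) hM _ n)

/-- `Ω_n ⊆ Ω_m` for `m ≤ n`. [cite: Balaban1988Convergent, (2.13) pp.256–257] -/
theorem maxDomT_antitone (hM : 1 ≤ M₁) (Ω : Set (Site P 0)) {m n : ℕ} (h : m ≤ n) :
    maxDomT M₁ Ω n ⊆ maxDomT M₁ Ω m :=
  Set.image_mono (maxDom_antitone (one_le_L P) hM _ h)

/-- `Ω_n ⊆ Ω` (*"with a support in Ω"*). [cite: Balaban1988Convergent, (2.13) pp.256–257] -/
theorem maxDomT_subset (hM : 1 ≤ M₁) (Ω : Set (Site P 0)) (n : ℕ) : maxDomT M₁ Ω n ⊆ Ω := by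
  have h := maxDomT_antitone (P := P) hM Ω (Nat.zero_le n)
  rwa [maxDomT_zero] at h

/-- The torus maximal sequence is monotone in `Ω`. [cite: Balaban1988Convergent, (2.13) pp.256–257] -/
theorem maxDomT_mono {Ω Ω' : Set (Site P 0)} (h : Ω ⊆ Ω') (n : ℕ) : maxDomT M₁ Ω n ⊆ maxDomT M₁ Ω' n :=
  Set.image_mono (maxDom_mono P.L M₁ (Set.preimage_mono h) n)

/-- Non-degeneracy on the cover: the maximal sequence of the whole lattice is constant, `(ℤᵈ)_n = ℤᵈ`.
[cite: Balaban1988Convergent, (2.13) pp.256–257] -/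
theorem maxDom_univ (L M₁' : ℕ) {d : ℕ} (n : ℕ) : maxDom L M₁' (Set.univ : Set (Pt d)) n = Set.univ := by
  induction n with
  | zero => rfl
  | succ n ih =>
    refine Set.eq_univ_of_forall fun x => ?_
    rw [mem_maxDom_succ]
    intro _ _ y _
    rw [ih]; exact Set.mem_univ y

/-- Non-degeneracy on the torus: for `Ω = T_ξ` the whole torus every maximal domain is the whole torus, `(T_ξ)_n = T_ξ`
(so `𝐁_j(T_ξ)` is the one-scale determining set `Γ_j = T^{(j)}`, `Bj_univ_top`). [cite: Balaban1988Convergent, (2.13) pp.256–257] -/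
theorem maxDomT_univ (n : ℕ) : maxDomT M₁ (Set.univ : Set (Site P 0)) n = Set.univ := by
  unfold maxDomT
  rw [Set.preimage_univ, maxDom_univ, Set.image_univ_of_surjective cover_surjective]

/-- *"Ω_n is a union of LⁿξM₁-cubes"* (read on the cover), for every `n ≤ j`, when `Ω` *"is a union of M₁-cubes in the
lattice T_ξ"* (`s_j`-cubes on the cover). [cite: Balaban1988Convergent, (2.13) pp.256–257] -/
theorem isUnionOfCubes_preimage_maxDomT (hM : 1 ≤ M₁) {Ω : Set (Site P 0)} {j : ℕ}
    (hdiv : side P.L M₁ j ∣ P.sitesPerDir 0) (hΩ : IsUnionOfCubes (side P.L M₁ j) (cover P ⁻¹' Ω)) {n : ℕ}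
    (hn : n ≤ j) : IsUnionOfCubes (side P.L M₁ n) (cover P ⁻¹' maxDomT M₁ Ω n) := by
  rw [preimage_maxDomT hM hdiv hn]
  exact isUnionOfCubes_maxDom hΩ hn

/-- **The printed distance condition** *"dist(Ω_n, Ωᶜ_{n−1}) ≧ LⁿξM₁ (the distance is for the lattice T_ξ)"*, read on the
cover: a cover point within sup-distance `< s_{n+1}` of a point over `Ω_{n+1}` lies over `Ω_n` (`n + 1 ≤ j`).
[cite: Balaban1988Convergent, (2.13) pp.256–257] -/
theorem dist_maxDomT (hM : 1 ≤ M₁) {Ω : Set (Site P 0)} {j : ℕ} (hdiv : side P.L M₁ j ∣ P.sitesPerDir 0) {n : ℕ}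
    (hn : n + 1 ≤ j) {x : Pt P.d} (hx : cover P x ∈ maxDomT M₁ Ω (n + 1)) {y : Pt P.d}
    (hy : Within ((side P.L M₁ (n + 1) : ℤ) - 1) x y) : cover P y ∈ maxDomT M₁ Ω n := by
  have hx' : x ∈ cover P ⁻¹' maxDomT M₁ Ω (n + 1) := hx
  rw [preimage_maxDomT hM hdiv hn] at hx'
  have hy' : y ∈ maxDom P.L M₁ (cover P ⁻¹' Ω) n := dist_maxDom P.L M₁ _ n hx' hy
  rw [← preimage_maxDomT hM hdiv (Nat.le_of_succ_le hn)] at hy'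
  exact hy'

/-- **MAXIMALITY** (*"a sequence of maximal domains"*): every torus sequence `D₀ ⊆ Ω` whose pull-backs are unions of
`s_{n+1}`-cubes with the printed distance condition lies inside the constructed one termwise, `D_n ⊆ Ω_n` — r11's
`seq_subset_maxDom` on the cover (no divisibility needed). [cite: Balaban1988Convergent, (2.13) pp.256–257] -/
theorem seq_subset_maxDomT (Ω : Set (Site P 0)) (D : ℕ → Set (Site P 0)) (h0 : D 0 ⊆ Ω)
    (hcubes : ∀ n, IsUnionOfCubes (side P.L M₁ (n + 1)) (cover P ⁻¹' D (n + 1)))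
    (hdist : ∀ n, ∀ x ∈ cover P ⁻¹' D (n + 1), ∀ y, Within ((side P.L M₁ (n + 1) : ℤ) - 1) x y → y ∈ cover P ⁻¹' D n)
    (n : ℕ) : D n ⊆ maxDomT M₁ Ω n := by
  have h := seq_subset_maxDom P.L M₁ (cover P ⁻¹' Ω) (pullSeq D) (Set.preimage_mono h0) hcubes hdist n
  calc D n = cover P '' (cover P ⁻¹' D n) := (image_preimage (D n)).symm
    _ ⊆ maxDomT M₁ Ω n := Set.image_mono h

/-- *"It is easy to see that dist(Ω_j, Ωᶜ) ≦ 2M₁, or Ω^{∼−2} ⊂ Ω_j, where the operation ∼ is taken for M₁-cubes"*: the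
image of `(π⁻¹Ω)^{∼−2}` (two layers of `s_j`-cubes removed on the cover) lies in `Ω_j` — r11's `innerN_two_subset_maxDom`
descended. [cite: Balaban1988Convergent, (2.13) pp.256–257] -/
theorem image_innerN_two_subset_maxDomT (hM : 1 ≤ M₁) (Ω : Set (Site P 0)) (j : ℕ) :
    cover P '' innerN (side P.L M₁ j) 2 (cover P ⁻¹' Ω) ⊆ maxDomT M₁ Ω j :=
  Set.image_mono (innerN_two_subset_maxDom (two_le_L P) hM _ j)

end Torus

/-! ## §3  The torus maximal domains are unions of blocks of `Setup` -/

section Blocks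

variable {P : Params}

/-- Labels of the iterated block map: `(blockIter n a)_μ = a_μ / Lⁿ` (label arithmetic of `Setup.blockOf`, standing
range `n ≤ m + K`). [cite: Balaban1987RG1, (0.1) p.251] -/
theorem val_blockIter {n : ℕ} (hn : n ≤ P.m + P.K) (a : Site P 0) (μ : Fin P.d) :
    ((blockIter n a) μ).val = (a μ).val / P.L ^ n := by
  induction n with
  | zero => simp
  | succ n ih =>
    rw [blockIter_succ, Site.val_blockOf (by omega), ih (by omega), Nat.div_div_eq_div_mul, pow_succ]

/-- Labels of the iterated centre embedding: `(embIter n y)_μ / Lⁿ = y_μ` (the `Lⁿ`-cube of the fine label of a coarse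
site is the coarse label; `Setup.emb` = centre, `L` odd; standing range). [cite: Balaban1987RG1, (0.1) p.251] -/
theorem val_embIter_div {n : ℕ} (hn : n ≤ P.m + P.K) (y : Site P n) (μ : Fin P.d) :
    ((embIter n y) μ).val / P.L ^ n = (y μ).val := by
  induction n with
  | zero => simp [embIter]
  | succ n ih =>
    have hL : 0 < P.L := P.L_pos
    have h2 : (P.L - 1) / 2 < P.L := by have := P.hL.2; omega
    show ((embIter n (emb y)) μ).val / P.L ^ (n + 1) = (y μ).val
    rw [pow_succ, ← Nat.div_div_eq_div_mul, ih (by omega), Site.val_emb (by omega), mul_comm,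
      Nat.mul_add_div hL, Nat.div_eq_of_lt h2, add_zero]

/-- Hence the representative point `embIter n (blockIter n a)` of the `n`-block of `a` has the same `Lⁿ`-label cube as
`a`. [cite: Balaban1987RG1, (0.1) p.251] -/
theorem val_embIter_blockIter_div {n : ℕ} (hn : n ≤ P.m + P.K) (a : Site P 0) (μ : Fin P.d) :
    ((embIter n (blockIter n a)) μ).val / P.L ^ n = (a μ).val / P.L ^ n := by
  rw [val_embIter_div hn, val_blockIter hn]

/-- On the cover: the standard lifts of `a` and of the representative point of its `n`-block lie in the same cube of
every partition whose side is a multiple of `Lⁿ`. [cite: Balaban1987RG1, (0.1) p.251] -/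
theorem cubeIdx_lift_blockRep {n : ℕ} (hn : n ≤ P.m + P.K) {s : ℕ} (hs : P.L ^ n ∣ s) (a : Site P 0) :
    cubeIdx s (lift P (embIter n (blockIter n a))) = cubeIdx s (lift P a) := by
  obtain ⟨t, rfl⟩ := hs
  funext μ
  simp only [cubeIdx, lift]
  rw [show ((P.L ^ n * t : ℕ) : ℤ) = ((P.L ^ n : ℕ) : ℤ) * (t : ℤ) by push_cast; ring,
    ← Int.ediv_ediv_of_nonneg (Int.natCast_nonneg _), ← Int.ediv_ediv_of_nonneg (Int.natCast_nonneg _)]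
  congr 1
  rw [← Int.natCast_div, ← Int.natCast_div, val_embIter_blockIter_div hn]

/-- **A deck-invariant union of `s`-cubes on the cover, `Lⁿ ∣ s`, descends to a union of `n`-blocks of `Setup`**
(`B14.Eq22Determines.IsBlockUnion`). [cite: Balaban1988Convergent, (2.1) p.255; Balaban1987RG1, (0.1) p.251] -/
theorem isBlockUnion_image {n : ℕ} (hn : n ≤ P.m + P.K) {s : ℕ} (hs : P.L ^ n ∣ s) {Y : Set (Pt P.d)}
    (hYdeck : ∀ x v, x + pmul (per P) v ∈ Y ↔ x ∈ Y) (hY : IsUnionOfCubes s Y) :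
    IsBlockUnion n (cover P '' Y) := by
  have hmem : ∀ b : Site P 0, b ∈ cover P '' Y ↔ lift P b ∈ Y := fun b => by
    have h : lift P b ∈ cover P ⁻¹' (cover P '' Y) ↔ lift P b ∈ Y := by rw [preimage_image_of_deck hYdeck]
    rwa [Set.mem_preimage, cover_lift] at h
  intro a
  rw [hmem, hmem]
  exact (hY _ _ (cubeIdx_lift_blockRep hn hs a)).symm

variable {M₁ : ℕ}

/-- **The torus maximal domain `Ω_{n+1}` is a union of `n`-blocks** (indeed of `(n+1)`-blocks: its cover is a union of
`L^{n+1}M₁`-cubes), `n + 1 ≤ j`, `n ≤ m + K`. [cite: Balaban1988Convergent, (2.13) pp.256–257] -/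
theorem isBlockUnion_maxDomT_succ (hM : 1 ≤ M₁) {Ω : Set (Site P 0)} {j : ℕ}
    (hdiv : side P.L M₁ j ∣ P.sitesPerDir 0) {n : ℕ} (hn : n + 1 ≤ j) (hnK : n ≤ P.m + P.K) :
    IsBlockUnion n (maxDomT M₁ Ω (n + 1)) := by
  refine isBlockUnion_image hnK ?_ (maxDom_cover_deck hM hdiv hn) (isUnionOfCubes_maxDom_succ P.L M₁ _ n)
  exact ⟨P.L * M₁, by unfold side; ring⟩

/-- The same for every `Ω_n`, `1 ≤ n ≤ j`, at its own scale: `Ω_n` is a union of `n`-blocks.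
[cite: Balaban1988Convergent, (2.13) pp.256–257] -/
theorem isBlockUnion_maxDomT (hM : 1 ≤ M₁) {Ω : Set (Site P 0)} {j : ℕ}
    (hdiv : side P.L M₁ j ∣ P.sitesPerDir 0) {n : ℕ} (hn1 : 1 ≤ n) (hn : n ≤ j) (hnK : n ≤ P.m + P.K) :
    IsBlockUnion n (maxDomT M₁ Ω n) := by
  obtain ⟨m, rfl⟩ : ∃ m, n = m + 1 := ⟨n - 1, by omega⟩
  refine isBlockUnion_image hnK ?_ (maxDom_cover_deck hM hdiv hn) (isUnionOfCubes_maxDom_succ P.L M₁ _ m)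
  exact ⟨M₁, by unfold side; ring⟩

end Blocks

/-! ## §4  (2.13): THE determining set `𝐁_j(Ω)` and the minimal configurations `U_{j,Ω}` -/

section DetSetBj

variable {P : Params} (M₁ : ℕ)

/-- **`𝐁_j(Ω)`** — *"We denote this determining set by 𝐁_j(Ω)"*: the determining set (2.2) (r12's `genSet`) of the torus
maximal sequence `{Ω_n}_{n=0}^{j}` of `Ω`. [cite: Balaban1988Convergent, (2.13) pp.256–257] -/
def Bj (Ω : Set (Site P 0)) (j : ℕ) : DetSet P := genSet (maxDomT M₁ Ω) j

variable {M₁}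

/-- Unfolding: the scale-`n` member of `𝐁_j(Ω)` is `(Γ_n)` of (2.2) for `{Ω_n}`. [cite: Balaban1988Convergent, (2.13) pp.256–257] -/
theorem Bj_apply (Ω : Set (Site P 0)) (j n : ℕ) : Bj M₁ Ω j n = pts n (gammaRegion (maxDomT M₁ Ω) j n) := rfl

/-- `Γ₀ = Ω₁ᶜ` (`j ≥ 1`): at the finest scale `𝐁_j(Ω)` carries everything outside `Ω₁`.
[cite: Balaban1988Convergent, (2.2) p.255, (2.13) pp.256–257] -/
theorem Bj_zero {Ω : Set (Site P 0)} {j : ℕ} (hj : 0 < j) : Bj M₁ Ω j 0 = (maxDomT M₁ Ω 1)ᶜ := by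
  rw [Bj_apply, gammaRegion_zero _ hj, pts_zero]

/-- `Γ_n = Ω_n^{(n)} ∖ Ω_{n+1}^{(n)}` for `1 ≤ n < j`. [cite: Balaban1988Convergent, (2.2) p.255, (2.13) pp.256–257] -/
theorem Bj_mid {Ω : Set (Site P 0)} {j n : ℕ} (h0 : 0 < n) (hnj : n < j) :
    Bj M₁ Ω j n = pts n (maxDomT M₁ Ω n) \ pts n (maxDomT M₁ Ω (n + 1)) := by
  rw [Bj_apply, gammaRegion_mid _ h0 hnj]
  rfl

/-- `Γ_j = Ω_j^{(j)}`. [cite: Balaban1988Convergent, (2.2) p.255, (2.13) pp.256–257] -/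
theorem Bj_top (Ω : Set (Site P 0)) (j : ℕ) : Bj M₁ Ω j j = pts j (maxDomT M₁ Ω j) := by
  rw [Bj_apply, gammaRegion_self]

/-- No member above the top scale. [cite: Balaban1988Convergent, (2.2) p.255, (2.13) pp.256–257] -/
theorem Bj_of_gt {Ω : Set (Site P 0)} {j n : ℕ} (h : j < n) : Bj M₁ Ω j n = ∅ := by
  rw [Bj_apply, gammaRegion_of_gt _ h]
  rfl

/-- For the whole torus `Ω = T_ξ` the top member is everything at scale `j`: `𝐁_j(T_ξ)_j = T^{(j)}` (the one-scale
constraint of [I] (0.21), r12's `atScale j` at that scale). [cite: Balaban1988Convergent, (2.13) pp.256–257] -/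
theorem Bj_univ_top (j : ℕ) : Bj M₁ (Set.univ : Set (Site P 0)) j j = Set.univ := by
  rw [Bj_top, maxDomT_univ, pts, Set.preimage_univ]

/-- The members of `𝐁_j(Ω)` live over `Ω` at the positive scales (*"with a support in Ω"*): `Γ_n ⊆ Ω^{(n)}` for
`1 ≤ n`. [cite: Balaban1988Convergent, (2.13) pp.256–257] -/
theorem Bj_subset_pts {Ω : Set (Site P 0)} (hM : 1 ≤ M₁) {j n : ℕ} (h0 : 0 < n) : Bj M₁ Ω j n ⊆ pts n Ω := by
  rcases lt_trichotomy n j with hnj | rfl | hjn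
  · rw [Bj_mid h0 hnj]
    exact fun y hy => Set.preimage_mono (maxDomT_subset hM Ω n) hy.1
  · rw [Bj_top]
    exact Set.preimage_mono (maxDomT_subset hM Ω n)
  · rw [Bj_of_gt hjn]
    exact Set.empty_subset _

/-- **"𝐁_j(Ω) determines {Ω_n}"** ((2.2) p. 255 for THIS determining set): two domains `Ω, Ω′ ⊂ T_ξ` with
`𝐁_j(Ω) = 𝐁_j(Ω′)` have the same maximal domains `Ω_n = Ω′_n`, `1 ≤ n ≤ j` (standing divisibility `s_j ∣ 2L^{m+K}`,
`j ≤ m + K + 1`) — `B14.Eq22Determines.eq_of_genSet_eq` by name, its nestedness and block-union hypotheses discharged by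
§2/§3. [cite: Balaban1988Convergent, (2.2) p.255, (2.13) pp.256–257] -/
theorem maxDomT_eq_of_Bj_eq (hM : 1 ≤ M₁) {Ω Ω' : Set (Site P 0)} {j : ℕ} (hj : 0 < j) (hjK : j ≤ P.m + P.K + 1)
    (hdiv : side P.L M₁ j ∣ P.sitesPerDir 0) (h : Bj M₁ Ω j = Bj M₁ Ω' j) :
    ∀ n, 1 ≤ n → n ≤ j → maxDomT M₁ Ω n = maxDomT M₁ Ω' n :=
  eq_of_genSet_eq hj (fun n _ _ => maxDomT_succ_subset hM Ω n) (fun n _ _ => maxDomT_succ_subset hM Ω' n)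
    (fun n _ hnj => isBlockUnion_maxDomT_succ hM hdiv hnj (by omega))
    (fun n _ hnj => isBlockUnion_maxDomT_succ hM hdiv hnj (by omega)) h

variable {G : Type*} [GaugeGroup G] {av : ∀ j, Averaging P j G}

variable (M₁) in
/-- **(2.13)** *"and the corresponding minimal configurations by U(𝐁_j(Ω), ·) = U_{j,Ω}(·)"*: `U_{j,Ω}(V)` := the solution
datum of (2.12) (r12's `DetBackground.U`) AT the determining set `𝐁_j(Ω)` — NAMING; existence/uniqueness of the minimal
orbit is [Balaban1985Variational] Thm 1 (rows B14.Eq2.12, B11.Thm1), carried by the datum.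
[cite: Balaban1988Convergent, (2.13) pp.256–257] -/
def minConf (bg : DetBackground P G av) (Ω : Set (Site P 0)) (j : ℕ) (V : MSField P G) : GaugeField P 0 G :=
  bg.U (Bj M₁ Ω j) V

/-- `U_{j,Ω}(V)` IS a minimal configuration of (2.12) for the determining set `𝐁_j(Ω)` and the data `V` (for `V` in the
domain of the solution map). [cite: Balaban1988Convergent, (2.12)–(2.13) pp.256–257] -/
theorem isMinimizer_minConf (bg : DetBackground P G av) {Ω : Set (Site P 0)} {j : ℕ} {V : MSField P G}
    (hV : V ∈ bg.dom (Bj M₁ Ω j)) : IsMinimizer av bg.reg (Bj M₁ Ω j) V (minConf M₁ bg Ω j V) :=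
  bg.isMinimizer _ _ hV

end DetSetBj

/-! ## §5  (2.14)–(2.15): `Ω^{∼−2}` on the torus, the join `𝐁 ∪ 𝐁_j(Ω)`, and `U_{𝐁,Ω}` -/

section Join

variable {P : Params} (M₁ : ℕ)

/-- **`Ω^{∼−2}` on the torus** (*"where the operation ∼ is taken for M₁-cubes"*): the image of r11's `innerN (s_j) 2` of the
pull-back (two layers of `s_j`-cubes removed on the cover). [cite: Balaban1988Convergent, (2.13)–(2.14) pp.256–257] -/
def innerTwoT (Ω : Set (Site P 0)) (j : ℕ) : Set (Site P 0) :=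
  cover P '' innerN (side P.L M₁ j) 2 (cover P ⁻¹' Ω)

variable {M₁}

/-- `π⁻¹ Ω^{∼−2} = (π⁻¹Ω)^{∼−2}` (`s_j ∣ 2L^{m+K}`). [cite: Balaban1988Convergent, (2.13)–(2.14) pp.256–257] -/
theorem preimage_innerTwoT (hM : 1 ≤ M₁) {Ω : Set (Site P 0)} {j : ℕ} (hdiv : side P.L M₁ j ∣ P.sitesPerDir 0) :
    cover P ⁻¹' innerTwoT M₁ Ω j = innerN (side P.L M₁ j) 2 (cover P ⁻¹' Ω) :=
  preimage_image_of_deck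
    (innerN_add_pmul (fun _ => hdiv) (side_pos (one_le_L P) hM j) (preimage_deck Ω))

/-- `Ω^{∼−2} ⊆ Ω`. [cite: Balaban1988Convergent, (2.13)–(2.14) pp.256–257] -/
theorem innerTwoT_subset (Ω : Set (Site P 0)) (j : ℕ) : innerTwoT M₁ Ω j ⊆ Ω := by
  rintro _ ⟨x, hx, rfl⟩
  exact innerN_subset _ _ _ hx

/-- *"Ω^{∼−2} ⊂ Ω_j"* on the torus. [cite: Balaban1988Convergent, (2.13) pp.256–257] -/
theorem innerTwoT_subset_maxDomT (hM : 1 ≤ M₁) (Ω : Set (Site P 0)) (j : ℕ) :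
    innerTwoT M₁ Ω j ⊆ maxDomT M₁ Ω j :=
  image_innerN_two_subset_maxDomT hM Ω j

variable (M₁) in
/-- **(2.14)** *"Take the set 𝐁_j(Ω), and form a new determining set by 𝐁∪𝐁_j(Ω) = (𝐁 ∩ Ω^{∼−2}) ∪ (𝐁_j(Ω) ∩ (Ω∖Ω^{∼−2}))"*:
r12's `join214` AT `𝐁_j(Ω)` and the torus `Ω^{∼−2}`. [cite: Balaban1988Convergent, (2.14) p.257] -/
def joinBj (𝔹 : DetSet P) (Ω : Set (Site P 0)) (j : ℕ) : DetSet P :=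
  join214 𝔹 (Bj M₁ Ω j) Ω (innerTwoT M₁ Ω j)

/-- Unfolding of (2.14) scale by scale: `(𝐁∪𝐁_j(Ω))_n = (𝐁_n ∩ (Ω^{∼−2})^{(n)}) ∪ (𝐁_j(Ω)_n ∩ (Ω∖Ω^{∼−2})^{(n)})`.
[cite: Balaban1988Convergent, (2.14) p.257] -/
theorem joinBj_apply (𝔹 : DetSet P) (Ω : Set (Site P 0)) (j n : ℕ) :
    joinBj M₁ 𝔹 Ω j n
      = (𝔹 n ∩ pts n (innerTwoT M₁ Ω j)) ∪ (Bj M₁ Ω j n ∩ pts n (Ω \ innerTwoT M₁ Ω j)) := rfl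

/-- Outside `Ω` the join keeps nothing at the positive scales: `(𝐁∪𝐁_j(Ω))_n ⊆ Ω^{(n)}` for `1 ≤ n` (both pieces of (2.14)
are localized in `Ω`). [cite: Balaban1988Convergent, (2.14) p.257] -/
theorem joinBj_subset_pts (hM : 1 ≤ M₁) (𝔹 : DetSet P) (Ω : Set (Site P 0)) {j n : ℕ} (h0 : 0 < n) :
    joinBj M₁ 𝔹 Ω j n ⊆ pts n Ω := by
  rw [joinBj_apply]
  rintro y (⟨-, hy⟩ | ⟨hy, -⟩)
  · exact Set.preimage_mono (innerTwoT_subset Ω j) hy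
  · exact Bj_subset_pts hM h0 hy

variable {G : Type*} [GaugeGroup G] {av : ∀ j, Averaging P j G}

variable (M₁) in
/-- **(2.15)** *"The corresponding function is denoted by U(𝐁∪𝐁_j(Ω), ·) = U_{𝐁,Ω}(·)"*: the solution datum of (2.12) AT the
join (2.14) — NAMING. [cite: Balaban1988Convergent, (2.15) p.257] -/
def minConfJoin (bg : DetBackground P G av) (𝔹 : DetSet P) (Ω : Set (Site P 0)) (j : ℕ) (V : MSField P G) :
    GaugeField P 0 G :=
  bg.U (joinBj M₁ 𝔹 Ω j) V

/-- `U_{𝐁,Ω}(V)` IS a minimal configuration of (2.12) for the determining set `𝐁∪𝐁_j(Ω)` (for `V` in the domain of the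
solution map). [cite: Balaban1988Convergent, (2.12) p.256, (2.15) p.257] -/
theorem isMinimizer_minConfJoin (bg : DetBackground P G av) {𝔹 : DetSet P} {Ω : Set (Site P 0)} {j : ℕ}
    {V : MSField P G} (hV : V ∈ bg.dom (joinBj M₁ 𝔹 Ω j)) :
    IsMinimizer av bg.reg (joinBj M₁ 𝔹 Ω j) V (minConfJoin M₁ bg 𝔹 Ω j V) :=
  bg.isMinimizer _ _ hV

end Join

end Literature.MathematicalPhysics.QuantumFieldTheory.Balaban1983to89.B14.Eq213DetSet
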